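import Mathlib
import HarnessLib
import Literature.MathematicalPhysics.QuantumLattice.HubbardInteractionKernels
import Literature.MathematicalPhysics.QuantumLattice.GrassmannKernelAntisymmetry

/-!
# Route `KLProgramme` — crux C4a, S1 (c) toolkit: the quartic kernel of the bare Hubbard vertex at ARBITRARY leg strings

Cell `gate-hubbard-kl`, lane hubbard-kl-c4a-1 (g6); helper for stub (C) `stub_twoLeg_curvature` of the engine-flow child `KLRegimeEngineV17F2`
(stmt-HubbardSuperconductivity-20437); memo HOME/hubbard-kl-c4a-1/C4A-PLAN.md §22.10.  The explicit second cumulant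
(`…C4aSecondCumulantDegree.kernel_four_secondCumulant_hubbardInteractionCT_explicit`) reads the bare quartic kernel `kernel V_U 4` at leg strings two of
whose legs are line ends `ψ̂^∓_{pσ}` of arbitrary spin and charge.  `Literature.….kernel_hubbardInteraction_vertexLegs_comp_perm` evaluates it at a
PERMUTED VERTEX STRING; this file turns that into evaluations at strings given by their charge pattern, with the spins symbolic:

* §1 vanishing: two legs of the same `(spin, charge)` type kill the kernel (`kernel_hubbardInteraction_eq_zero_of_type_eq`), hence so do three legs of
  the same charge (`kernel_hubbardInteraction_eq_zero_of_three_charges`);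
* §2 **`kernel_hubbardInteraction_mmpp`** — the master evaluation at a `(−,−,+,+)` string `(a s₁ −, b s₂ −, c s₃ +, d s₄ +)`:
  `[s₁ ≠ s₂][s₃ ≠ s₄]·(−1)^{[s₁ = s₃]}·[n_a + n_b = n_c + n_d ∧ a⃗ + b⃗ = c⃗ + d⃗]·U(βL²)⁻³·(4!)⁻¹`;
* §3 the other two-plus-two-minus charge patterns by antisymmetry (`kernel_hubbardInteraction_ppmm/_mpmp/_pmpm/_pmmp/_mppm`).

Exact algebra; nothing about sizes; nothing asserts superconductivity.  Reference: BGM 2006 §2.1 (2.6a) [cite: BenfattoGiulianiMastropietro2006].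
-/

noncomputable section

namespace Summit.HubbardSuperconductivity.HubbardSuperconductivity.Theorems.C4a

set_option linter.dupNamespace false -- summit = problem name (single-conjunct summit), D-0017

open Literature.MathematicalPhysics.QuantumLattice Literature.Probability.LatticeModels GrassmannAlgebra Finset Matrix

variable {L M : ℕ} [NeZero L]

/-! ## §1 Vanishing: repeated types, three equal charges -/

omit [NeZero L] in
/-- The four slots of a vertex string have pairwise distinct `(spin, charge)` types. -/
theorem vertexLegs_slot_eq {κ : Fin 4 → FreqMomentum L M} {j j' : Fin 4} (hs : (vertexLegs L M κ j).1.2 = (vertexLegs L M κ j').1.2)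
    (hc : (vertexLegs L M κ j).2 = (vertexLegs L M κ j').2) : j = j' := by
  fin_cases j <;> fin_cases j' <;> simp_all [vertexLegs]

/-- **Two legs of the same `(spin, charge)` type kill the quartic kernel of `V_U`** (every vertex monomial has the four types once each: in the
Leibniz expansion of the delta determinant the two legs would have to sit in the same slot). [cite: BenfattoGiulianiMastropietro2006, §2.1 (2.6a)] -/
theorem kernel_hubbardInteraction_eq_zero_of_type_eq (β U : ℝ) (X : Fin 4 → HubbardFieldIdx L M) {i i' : Fin 4} (hii' : i ≠ i')
    (hs : (X i).1.2 = (X i').1.2) (hc : (X i).2 = (X i').2) : kernel ℂ (hubbardInteraction L M β U) 4 X = 0 := by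
  rw [hubbardInteraction_eq_sum_smul, kernel_sum]
  refine Finset.sum_eq_zero fun κ _ => ?_
  rw [kernel_smul, vertexMonomial_eq_genProd, kernel_genProd, Matrix.det_apply]
  refine mul_eq_zero_of_right _ (mul_eq_zero_of_right _ (Finset.sum_eq_zero fun σ _ => ?_))
  by_cases h : X i = vertexLegs L M κ (σ.symm i)
  · by_cases h' : X i' = vertexLegs L M κ (σ.symm i')
    · exfalso
      refine hii' (σ.symm.injective (vertexLegs_slot_eq (κ := κ) ?_ ?_))
      · rw [← h, ← h', hs]
      · rw [← h, ← h', hc]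
    · rw [Finset.prod_eq_zero (Finset.mem_univ (σ.symm i')) (by simp [deltaMatrix_apply, h']), smul_zero]
  · rw [Finset.prod_eq_zero (Finset.mem_univ (σ.symm i)) (by simp [deltaMatrix_apply, h]), smul_zero]

/-- **Three legs of the same charge kill the quartic kernel of `V_U`** (two of them have the same spin). -/
theorem kernel_hubbardInteraction_eq_zero_of_three_charges (β U : ℝ) (X : Fin 4 → HubbardFieldIdx L M) {i j k : Fin 4} (hij : i ≠ j)
    (hik : i ≠ k) (hjk : j ≠ k) (hcj : (X i).2 = (X j).2) (hck : (X i).2 = (X k).2) : kernel ℂ (hubbardInteraction L M β U) 4 X = 0 := by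
  by_cases h₁ : (X i).1.2 = (X j).1.2
  · exact kernel_hubbardInteraction_eq_zero_of_type_eq β U X hij h₁ hcj
  by_cases h₂ : (X i).1.2 = (X k).1.2
  · exact kernel_hubbardInteraction_eq_zero_of_type_eq β U X hik h₂ hck
  have h₃ : (X j).1.2 = (X k).1.2 := by
    have two : ∀ s : Fin 2, s = 0 ∨ s = 1 := by decide
    rcases two (X i).1.2 with hi | hi <;> rcases two (X j).1.2 with hj | hj <;> rcases two (X k).1.2 with hk | hk <;> rw [hj, hk] <;>
      first | rfl | (exfalso; rw [hi, hj] at h₁; exact h₁ rfl) | (exfalso; rw [hi, hk] at h₂; exact h₂ rfl)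
  exact kernel_hubbardInteraction_eq_zero_of_type_eq β U X hjk h₃ (hcj.symm.trans hck)

/-! ## §2 The master evaluation at a `(−,−,+,+)` string -/

omit [NeZero L] in
/-- The conservation indicator of a `(−,−,+,+)` string: integer frequency labels `n_a + n_b = n_c + n_d` and torus momenta `a⃗ + b⃗ = c⃗ + d⃗`. -/
theorem vertexConserving_iff_mmpp (a b c d : FreqMomentum L M) (κ : Fin 4 → FreqMomentum L M)
    (h02 : (κ 0 = c ∧ κ 2 = d) ∨ (κ 0 = d ∧ κ 2 = c)) (h13 : (κ 1 = a ∧ κ 3 = b) ∨ (κ 1 = b ∧ κ 3 = a)) :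
    vertexConserving L M κ ↔ (matsubaraInt M a.1 + matsubaraInt M b.1 = matsubaraInt M c.1 + matsubaraInt M d.1 ∧ a.2 + b.2 = c.2 + d.2) := by
  unfold vertexConserving
  rcases h02 with ⟨h0, h2⟩ | ⟨h0, h2⟩ <;> rcases h13 with ⟨h1, h3⟩ | ⟨h1, h3⟩ <;> rw [h0, h1, h2, h3] <;>
    (try simp only [add_comm (matsubaraInt M d.1), add_comm d.2, add_comm (matsubaraInt M b.1), add_comm b.2]) <;>
    constructor <;> exact fun h => ⟨h.1.symm, h.2.symm⟩

omit [NeZero L] in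
/-- `(a↑−, b↓−, c↑+, d↓+) = vertexLegs (c, a, d, b) ∘ (0↦1, 1↦3, 2↦0, 3↦2)` (a `4`-cycle, odd). -/
private theorem string_udud (a b c d : FreqMomentum L M) :
    (![((a, 0), 1), ((b, 1), 1), ((c, 0), 0), ((d, 1), 0)] : Fin 4 → HubbardFieldIdx L M) =
      vertexLegs L M ![c, a, d, b] ∘ (Equiv.swap (0 : Fin 4) 1 * Equiv.swap (1 : Fin 4) 3 * Equiv.swap (3 : Fin 4) 2) := by
  funext i
  fin_cases i <;> simp [vertexLegs, Equiv.swap_apply_def]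

omit [NeZero L] in
/-- `(a↑−, b↓−, c↓+, d↑+) = vertexLegs (d, a, c, b) ∘ (0↦1, 1↦3, 2↦2, 3↦0)` (a `3`-cycle, even). -/
private theorem string_uddu (a b c d : FreqMomentum L M) :
    (![((a, 0), 1), ((b, 1), 1), ((c, 1), 0), ((d, 0), 0)] : Fin 4 → HubbardFieldIdx L M) =
      vertexLegs L M ![d, a, c, b] ∘ (Equiv.swap (0 : Fin 4) 1 * Equiv.swap (1 : Fin 4) 3) := by
  funext i
  fin_cases i <;> simp [vertexLegs, Equiv.swap_apply_def]

omit [NeZero L] in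
/-- `(a↓−, b↑−, c↑+, d↓+) = vertexLegs (c, b, d, a) ∘ (0↦3, 1↦1, 2↦0, 3↦2)` (a `3`-cycle, even). -/
private theorem string_duud (a b c d : FreqMomentum L M) :
    (![((a, 1), 1), ((b, 0), 1), ((c, 0), 0), ((d, 1), 0)] : Fin 4 → HubbardFieldIdx L M) =
      vertexLegs L M ![c, b, d, a] ∘ (Equiv.swap (0 : Fin 4) 3 * Equiv.swap (3 : Fin 4) 2) := by
  funext i
  fin_cases i <;> simp [vertexLegs, Equiv.swap_apply_def]

omit [NeZero L] in
/-- `(a↓−, b↑−, c↓+, d↑+) = vertexLegs (d, b, c, a) ∘ (0 3)` (odd). -/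
private theorem string_dudu (a b c d : FreqMomentum L M) :
    (![((a, 1), 1), ((b, 0), 1), ((c, 1), 0), ((d, 0), 0)] : Fin 4 → HubbardFieldIdx L M) =
      vertexLegs L M ![d, b, c, a] ∘ Equiv.swap (0 : Fin 4) 3 := by
  funext i
  fin_cases i <;> simp [vertexLegs, Equiv.swap_apply_def]

/-- **THE MASTER EVALUATION** of the quartic kernel of `V_U` at a `(−,−,+,+)` string `(ψ̂⁻_{a s₁}, ψ̂⁻_{b s₂}, ψ̂⁺_{c s₃}, ψ̂⁺_{d s₄})`:
`[s₁ ≠ s₂][s₃ ≠ s₄]·(−1)^{[s₁ = s₃]}·[n_a + n_b = n_c + n_d ∧ a⃗ + b⃗ = c⃗ + d⃗]·U(βL²)⁻³·(4!)⁻¹` — of the vertex monomials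
`ψ̂⁺_{κ₀↑}ψ̂⁻_{κ₁↑}ψ̂⁺_{κ₂↓}ψ̂⁻_{κ₃↓}` exactly the one whose slots carry these four labels overlaps, with the sign of the reordering.
[cite: BenfattoGiulianiMastropietro2006, §2.1 (2.6a)] -/
theorem kernel_hubbardInteraction_mmpp (β U : ℝ) (a b c d : FreqMomentum L M) (s₁ s₂ s₃ s₄ : Fin 2) :
    kernel ℂ (hubbardInteraction L M β U) 4 ![((a, s₁), 1), ((b, s₂), 1), ((c, s₃), 0), ((d, s₄), 0)] =
      if s₁ ≠ s₂ ∧ s₃ ≠ s₄ then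
        (if s₁ = s₃ then -1 else 1) *
          ((if matsubaraInt M a.1 + matsubaraInt M b.1 = matsubaraInt M c.1 + matsubaraInt M d.1 ∧ a.2 + b.2 = c.2 + d.2 then
              (((U / (β * (L : ℝ) ^ 2) ^ 3 : ℝ)) : ℂ) else 0) * (((4 : ℕ).factorial : ℚ)⁻¹ • (1 : ℂ)))
      else 0 := by
  by_cases h12 : s₁ = s₂
  · subst h12
    rw [if_neg (by simp)]
    exact kernel_hubbardInteraction_eq_zero_of_type_eq β U _ (i := 0) (i' := 1) (by decide) rfl rfl
  by_cases h34 : s₃ = s₄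
  · subst h34
    rw [if_neg (by simp)]
    exact kernel_hubbardInteraction_eq_zero_of_type_eq β U _ (i := 2) (i' := 3) (by decide) rfl rfl
  rw [if_pos ⟨h12, h34⟩]
  have hcond := fun (κ : Fin 4 → FreqMomentum L M) h02 h13 => vertexConserving_iff_mmpp a b c d κ h02 h13
  have two : ∀ s : Fin 2, s = 0 ∨ s = 1 := by decide
  rcases two s₁ with rfl | rfl <;> rcases two s₃ with rfl | rfl
  · -- `s₁ = s₃ = ↑`, `s₂ = s₄ = ↓`
    obtain rfl : s₂ = 1 := by rcases two s₂ with h | h; exact absurd h.symm h12; exact h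
    obtain rfl : s₄ = 1 := by rcases two s₄ with h | h; exact absurd h.symm h34; exact h
    rw [string_udud, kernel_hubbardInteraction_vertexLegs_comp_perm, if_pos (rfl : (0 : Fin 2) = 0),
      show Equiv.Perm.sign (Equiv.swap (0 : Fin 4) 1 * Equiv.swap (1 : Fin 4) 3 * Equiv.swap (3 : Fin 4) 2) = -1 by decide]
    by_cases hc : matsubaraInt M a.1 + matsubaraInt M b.1 = matsubaraInt M c.1 + matsubaraInt M d.1 ∧ a.2 + b.2 = c.2 + d.2
    · rw [if_pos hc, if_pos ((hcond _ (Or.inl ⟨rfl, rfl⟩) (Or.inl ⟨rfl, rfl⟩)).2 hc)]; push_cast; ring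
    · rw [if_neg hc, if_neg (fun h => hc ((hcond _ (Or.inl ⟨rfl, rfl⟩) (Or.inl ⟨rfl, rfl⟩)).1 h))]; simp
  · -- `s₁ = ↑`, `s₃ = ↓`
    obtain rfl : s₂ = 1 := by rcases two s₂ with h | h; exact absurd h.symm h12; exact h
    obtain rfl : s₄ = 0 := by rcases two s₄ with h | h; exact h; exact absurd h.symm h34
    rw [string_uddu, kernel_hubbardInteraction_vertexLegs_comp_perm, if_neg (show (0 : Fin 2) ≠ 1 by decide),
      show Equiv.Perm.sign (Equiv.swap (0 : Fin 4) 1 * Equiv.swap (1 : Fin 4) 3) = 1 by decide]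
    by_cases hc : matsubaraInt M a.1 + matsubaraInt M b.1 = matsubaraInt M c.1 + matsubaraInt M d.1 ∧ a.2 + b.2 = c.2 + d.2
    · rw [if_pos hc, if_pos ((hcond _ (Or.inr ⟨rfl, rfl⟩) (Or.inl ⟨rfl, rfl⟩)).2 hc)]; push_cast; ring
    · rw [if_neg hc, if_neg (fun h => hc ((hcond _ (Or.inr ⟨rfl, rfl⟩) (Or.inl ⟨rfl, rfl⟩)).1 h))]; simp
  · -- `s₁ = ↓`, `s₃ = ↑`
    obtain rfl : s₂ = 0 := by rcases two s₂ with h | h; exact h; exact absurd h.symm h12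
    obtain rfl : s₄ = 1 := by rcases two s₄ with h | h; exact absurd h.symm h34; exact h
    rw [string_duud, kernel_hubbardInteraction_vertexLegs_comp_perm, if_neg (show (1 : Fin 2) ≠ 0 by decide),
      show Equiv.Perm.sign (Equiv.swap (0 : Fin 4) 3 * Equiv.swap (3 : Fin 4) 2) = 1 by decide]
    by_cases hc : matsubaraInt M a.1 + matsubaraInt M b.1 = matsubaraInt M c.1 + matsubaraInt M d.1 ∧ a.2 + b.2 = c.2 + d.2
    · rw [if_pos hc, if_pos ((hcond _ (Or.inl ⟨rfl, rfl⟩) (Or.inr ⟨rfl, rfl⟩)).2 hc)]; push_cast; ring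
    · rw [if_neg hc, if_neg (fun h => hc ((hcond _ (Or.inl ⟨rfl, rfl⟩) (Or.inr ⟨rfl, rfl⟩)).1 h))]; simp
  · -- `s₁ = s₃ = ↓`, `s₂ = s₄ = ↑`
    obtain rfl : s₂ = 0 := by rcases two s₂ with h | h; exact h; exact absurd h.symm h12
    obtain rfl : s₄ = 0 := by rcases two s₄ with h | h; exact h; exact absurd h.symm h34
    rw [string_dudu, kernel_hubbardInteraction_vertexLegs_comp_perm, if_pos (rfl : (1 : Fin 2) = 1),
      show Equiv.Perm.sign (Equiv.swap (0 : Fin 4) 3) = -1 by decide]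
    by_cases hc : matsubaraInt M a.1 + matsubaraInt M b.1 = matsubaraInt M c.1 + matsubaraInt M d.1 ∧ a.2 + b.2 = c.2 + d.2
    · rw [if_pos hc, if_pos ((hcond _ (Or.inr ⟨rfl, rfl⟩) (Or.inr ⟨rfl, rfl⟩)).2 hc)]; push_cast; ring
    · rw [if_neg hc, if_neg (fun h => hc ((hcond _ (Or.inr ⟨rfl, rfl⟩) (Or.inr ⟨rfl, rfl⟩)).1 h))]; simp

/-! ## §3 The other two-plus-two-minus charge patterns, by antisymmetry -/

/-- `(+,+,−,−)`: `kernel V_U 4 (c s₃ +, d s₄ +, a s₁ −, b s₂ −) = kernel V_U 4 (a s₁ −, b s₂ −, c s₃ +, d s₄ +)` (the reordering `(0 2)(1 3)` is even). -/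
theorem kernel_hubbardInteraction_ppmm (β U : ℝ) (a b c d : FreqMomentum L M) (s₁ s₂ s₃ s₄ : Fin 2) :
    kernel ℂ (hubbardInteraction L M β U) 4 ![((c, s₃), 0), ((d, s₄), 0), ((a, s₁), 1), ((b, s₂), 1)] =
      kernel ℂ (hubbardInteraction L M β U) 4 ![((a, s₁), 1), ((b, s₂), 1), ((c, s₃), 0), ((d, s₄), 0)] := by
  have h : (![((c, s₃), 0), ((d, s₄), 0), ((a, s₁), 1), ((b, s₂), 1)] : Fin 4 → HubbardFieldIdx L M) =
      (![((a, s₁), 1), ((b, s₂), 1), ((c, s₃), 0), ((d, s₄), 0)] : Fin 4 → HubbardFieldIdx L M) ∘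
        (Equiv.swap (0 : Fin 4) 2 * Equiv.swap (1 : Fin 4) 3) := by
    funext i; fin_cases i <;> simp [Equiv.swap_apply_def]
  rw [h, Literature.MathematicalPhysics.QuantumLattice.kernel_comp_perm,
    show Equiv.Perm.sign (Equiv.swap (0 : Fin 4) 2 * Equiv.swap (1 : Fin 4) 3) = 1 by decide]
  simp

/-- `(−,+,−,+)`: `kernel V_U 4 (a s₁ −, c s₃ +, b s₂ −, d s₄ +) = −kernel V_U 4 (a s₁ −, b s₂ −, c s₃ +, d s₄ +)` (the transposition `(1 2)`). -/
theorem kernel_hubbardInteraction_mpmp (β U : ℝ) (a b c d : FreqMomentum L M) (s₁ s₂ s₃ s₄ : Fin 2) :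
    kernel ℂ (hubbardInteraction L M β U) 4 ![((a, s₁), 1), ((c, s₃), 0), ((b, s₂), 1), ((d, s₄), 0)] =
      -kernel ℂ (hubbardInteraction L M β U) 4 ![((a, s₁), 1), ((b, s₂), 1), ((c, s₃), 0), ((d, s₄), 0)] := by
  have h : (![((a, s₁), 1), ((c, s₃), 0), ((b, s₂), 1), ((d, s₄), 0)] : Fin 4 → HubbardFieldIdx L M) =
      (![((a, s₁), 1), ((b, s₂), 1), ((c, s₃), 0), ((d, s₄), 0)] : Fin 4 → HubbardFieldIdx L M) ∘ Equiv.swap (1 : Fin 4) 2 := by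
    funext i; fin_cases i <;> simp [Equiv.swap_apply_def]
  rw [h, Literature.MathematicalPhysics.QuantumLattice.kernel_comp_perm, Equiv.Perm.sign_swap (by decide)]
  simp

/-- `(+,−,+,−)`: `kernel V_U 4 (c s₃ +, a s₁ −, d s₄ +, b s₂ −) = −kernel V_U 4 (a s₁ −, b s₂ −, c s₃ +, d s₄ +)` (a `4`-cycle). -/
theorem kernel_hubbardInteraction_pmpm (β U : ℝ) (a b c d : FreqMomentum L M) (s₁ s₂ s₃ s₄ : Fin 2) :
    kernel ℂ (hubbardInteraction L M β U) 4 ![((c, s₃), 0), ((a, s₁), 1), ((d, s₄), 0), ((b, s₂), 1)] =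
      -kernel ℂ (hubbardInteraction L M β U) 4 ![((a, s₁), 1), ((b, s₂), 1), ((c, s₃), 0), ((d, s₄), 0)] := by
  have h : (![((c, s₃), 0), ((a, s₁), 1), ((d, s₄), 0), ((b, s₂), 1)] : Fin 4 → HubbardFieldIdx L M) =
      (![((a, s₁), 1), ((b, s₂), 1), ((c, s₃), 0), ((d, s₄), 0)] : Fin 4 → HubbardFieldIdx L M) ∘
        (Equiv.swap (0 : Fin 4) 2 * Equiv.swap (2 : Fin 4) 3 * Equiv.swap (3 : Fin 4) 1) := by
    funext i; fin_cases i <;> simp [Equiv.swap_apply_def]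
  rw [h, Literature.MathematicalPhysics.QuantumLattice.kernel_comp_perm,
    show Equiv.Perm.sign (Equiv.swap (0 : Fin 4) 2 * Equiv.swap (2 : Fin 4) 3 * Equiv.swap (3 : Fin 4) 1) = -1 by decide]
  simp

/-- `(+,−,−,+)`: `kernel V_U 4 (c s₃ +, a s₁ −, b s₂ −, d s₄ +) = kernel V_U 4 (a s₁ −, b s₂ −, c s₃ +, d s₄ +)` (a `3`-cycle). -/
theorem kernel_hubbardInteraction_pmmp (β U : ℝ) (a b c d : FreqMomentum L M) (s₁ s₂ s₃ s₄ : Fin 2) :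
    kernel ℂ (hubbardInteraction L M β U) 4 ![((c, s₃), 0), ((a, s₁), 1), ((b, s₂), 1), ((d, s₄), 0)] =
      kernel ℂ (hubbardInteraction L M β U) 4 ![((a, s₁), 1), ((b, s₂), 1), ((c, s₃), 0), ((d, s₄), 0)] := by
  have h : (![((c, s₃), 0), ((a, s₁), 1), ((b, s₂), 1), ((d, s₄), 0)] : Fin 4 → HubbardFieldIdx L M) =
      (![((a, s₁), 1), ((b, s₂), 1), ((c, s₃), 0), ((d, s₄), 0)] : Fin 4 → HubbardFieldIdx L M) ∘
        (Equiv.swap (0 : Fin 4) 2 * Equiv.swap (2 : Fin 4) 1) := by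
    funext i; fin_cases i <;> simp [Equiv.swap_apply_def]
  rw [h, Literature.MathematicalPhysics.QuantumLattice.kernel_comp_perm,
    show Equiv.Perm.sign (Equiv.swap (0 : Fin 4) 2 * Equiv.swap (2 : Fin 4) 1) = 1 by decide]
  simp

/-- `(−,+,+,−)`: `kernel V_U 4 (a s₁ −, c s₃ +, d s₄ +, b s₂ −) = kernel V_U 4 (a s₁ −, b s₂ −, c s₃ +, d s₄ +)` (a `3`-cycle). -/
theorem kernel_hubbardInteraction_mppm (β U : ℝ) (a b c d : FreqMomentum L M) (s₁ s₂ s₃ s₄ : Fin 2) :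
    kernel ℂ (hubbardInteraction L M β U) 4 ![((a, s₁), 1), ((c, s₃), 0), ((d, s₄), 0), ((b, s₂), 1)] =
      kernel ℂ (hubbardInteraction L M β U) 4 ![((a, s₁), 1), ((b, s₂), 1), ((c, s₃), 0), ((d, s₄), 0)] := by
  have h : (![((a, s₁), 1), ((c, s₃), 0), ((d, s₄), 0), ((b, s₂), 1)] : Fin 4 → HubbardFieldIdx L M) =
      (![((a, s₁), 1), ((b, s₂), 1), ((c, s₃), 0), ((d, s₄), 0)] : Fin 4 → HubbardFieldIdx L M) ∘
        (Equiv.swap (1 : Fin 4) 2 * Equiv.swap (2 : Fin 4) 3) := by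
    funext i; fin_cases i <;> simp [Equiv.swap_apply_def]
  rw [h, Literature.MathematicalPhysics.QuantumLattice.kernel_comp_perm,
    show Equiv.Perm.sign (Equiv.swap (1 : Fin 4) 2 * Equiv.swap (2 : Fin 4) 3) = 1 by decide]
  simp

end Summit.HubbardSuperconductivity.HubbardSuperconductivity.Theorems.C4a

end
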